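import Summits.QuantumFields.YangMills.Theorems.AllWindowsColdBoxBoxHighLineBulkCurrency
import Summits.QuantumFields.YangMills.Theorems.WeakCouplingRatesColdBoxDirichletWick

/-!
# T-S5.13, final step — `LandauRelativeComparisonBulk θL` from the MAIN APPROXIMATION of the bulk covariance (ASSEMBLY-S5 §6 «CONCLUSION»)

Planner ym-idea-2 g18's `ASSEMBLY-S5.md` §6 ends: «each of the six errors (e1)–(e6) … is ≤ (1/32)·σ_H β⁻² ≤ (1/32)(3/4)boxDirCircSqCov·β⁻²; the total is
< (1/4)(3/4)boxDirCircSqCov·β⁻², leaving β²·Cov_box(c₀,c_T) ≥ (9/16)·boxDirCircSqCov ≥ (1/2)·boxDirCircSqCov (η = 1/2)».  This file isolates that last,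
purely algebraic step, so the assembly of `stub_landauSecondOrder` (v12; target ✓`LandauRelativeComparisonBulk θL` of `…BulkCurrency`) only has to produce the
MAIN APPROXIMATION in the bulk:

* ★`landauRelativeComparisonBulk_of_mainApprox` — if for every `0 < θ ≤ θL` there are `M ≥ 1`, `L`, `β₀` with
  `|β²·boxPlaqCov β H T − (3/4)·boxDirCircSqCov H T| ≤ (1/4)·((3/4)·boxDirCircSqCov H T)` for all `β ≥ β₀` and bulk `T` (`L ≤ T`, `M·T ≤ H = ⌈β^θ⌉₊`),
  then `LandauRelativeComparisonBulk θL` holds with `η = 1/2` (✓`boxDirCircSqCov_nonneg`);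
* `mainApprox_of_split` — the main approximation follows from ANY intermediate quantity `Φ β T` (the assembler takes the small-field FP-chart covariance
  `β²·Cov_{D,J}(c₀,c_T)`) with `|β²·boxPlaqCov − Φ| ≤ ε₁·(3/4)boxDirCircSqCov` (Steps A–C: ✓5J, ✓14, ✓6(cond), ✓6s) and `|Φ − (3/4)boxDirCircSqCov| ≤ ε₂·(3/4)boxDirCircSqCov`
  (Steps D–E: ✓11, ✓13m, ✓10, ✓12a–e, ✓13t, 13n/13r/13s), `ε₁ + ε₂ ≤ 1/4`, on a common bulk window.

Tree (✓BulkCurrency, ✓WeakCouplingRatesColdBoxDirichletWick) + Mathlib; no definitions.  HONEST LABEL: bookkeeping for the T-S5.13 assembly; S5 (`stub_landauSecondOrder`), U5,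
⟨stmt-QuantumFields-24004⟩ ⟨24335⟩ ⟨24336⟩ remain OPEN; route AllWindowsColdBox is DRAFT; no rung is proved; the Yang–Mills mass gap is NOT proved by this file; no summit is
proved by a line.  Seat ym-line-sfw-p2 g77 (LEAD, cell ym-idea-1; T-S5.13 assembler of record).
-/

set_option autoImplicit false

noncomputable section

open Summit.QuantumFields.YangMills.Theorems.WeakCouplingRates

namespace Summit.QuantumFields.YangMills.Theorems.AllWindowsColdBoxBoxHighLine

/-- ★ **Final step of T-S5.13**: the MAIN APPROXIMATION of the bulk covariance (relative error ≤ 1/4 against the main term `(3/4)·boxDirCircSqCov`) gives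
`LandauRelativeComparisonBulk θL` with `η = 1/2`. -/
theorem landauRelativeComparisonBulk_of_mainApprox (θL : ℝ)
    (h : ∀ θ : ℝ, 0 < θ → θ ≤ θL → ∃ M L β₀ : ℝ, 1 ≤ M ∧ ∀ β : ℝ, β₀ ≤ β → ∀ T : ℕ, L ≤ (T : ℝ) → M * (T : ℝ) ≤ (⌈β ^ θ⌉₊ : ℝ) →
      |β ^ 2 * boxPlaqCov (G := SU2) (Literature.MathematicalPhysics.QuantumLattice.fundamentalRep (Fin 2)) β ⌈β ^ θ⌉₊ T -
          3 / 4 * boxDirCircSqCov ⌈β ^ θ⌉₊ T| ≤ 1 / 4 * (3 / 4 * boxDirCircSqCov ⌈β ^ θ⌉₊ T)) :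
    LandauRelativeComparisonBulk θL := by
  intro θ hθ hθL
  obtain ⟨M, L, β₀, hM, hmain⟩ := h θ hθ hθL
  refine ⟨M, L, 1 / 2, β₀, hM, by norm_num, fun β hβ T hLT hMT => ?_⟩
  have hb := hmain β hβ T hLT hMT
  have h0 := boxDirCircSqCov_nonneg ⌈β ^ θ⌉₊ T
  have h1 := (abs_le.1 hb).1
  linarith

/-- The main approximation from a split through an intermediate quantity `Φ` (Steps A–C versus Steps D–E of ASSEMBLY-S5), on a common bulk window. -/
theorem mainApprox_of_split (θ : ℝ) (Φ : ℝ → ℕ → ℝ) {M L β₀ ε₁ ε₂ : ℝ} (hM : 1 ≤ M) (hε : ε₁ + ε₂ ≤ 1 / 4)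
    (hAC : ∀ β : ℝ, β₀ ≤ β → ∀ T : ℕ, L ≤ (T : ℝ) → M * (T : ℝ) ≤ (⌈β ^ θ⌉₊ : ℝ) →
      |β ^ 2 * boxPlaqCov (G := SU2) (Literature.MathematicalPhysics.QuantumLattice.fundamentalRep (Fin 2)) β ⌈β ^ θ⌉₊ T - Φ β T| ≤
        ε₁ * (3 / 4 * boxDirCircSqCov ⌈β ^ θ⌉₊ T))
    (hE : ∀ β : ℝ, β₀ ≤ β → ∀ T : ℕ, L ≤ (T : ℝ) → M * (T : ℝ) ≤ (⌈β ^ θ⌉₊ : ℝ) →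
      |Φ β T - 3 / 4 * boxDirCircSqCov ⌈β ^ θ⌉₊ T| ≤ ε₂ * (3 / 4 * boxDirCircSqCov ⌈β ^ θ⌉₊ T)) :
    ∃ M L β₀ : ℝ, 1 ≤ M ∧ ∀ β : ℝ, β₀ ≤ β → ∀ T : ℕ, L ≤ (T : ℝ) → M * (T : ℝ) ≤ (⌈β ^ θ⌉₊ : ℝ) →
      |β ^ 2 * boxPlaqCov (G := SU2) (Literature.MathematicalPhysics.QuantumLattice.fundamentalRep (Fin 2)) β ⌈β ^ θ⌉₊ T -
          3 / 4 * boxDirCircSqCov ⌈β ^ θ⌉₊ T| ≤ 1 / 4 * (3 / 4 * boxDirCircSqCov ⌈β ^ θ⌉₊ T) := by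
  refine ⟨M, L, β₀, hM, fun β hβ T hLT hMT => ?_⟩
  have h1 := hAC β hβ T hLT hMT
  have h2 := hE β hβ T hLT hMT
  have h0 := boxDirCircSqCov_nonneg ⌈β ^ θ⌉₊ T
  calc |β ^ 2 * boxPlaqCov (G := SU2) (Literature.MathematicalPhysics.QuantumLattice.fundamentalRep (Fin 2)) β ⌈β ^ θ⌉₊ T - 3 / 4 * boxDirCircSqCov ⌈β ^ θ⌉₊ T|
      ≤ |β ^ 2 * boxPlaqCov (G := SU2) (Literature.MathematicalPhysics.QuantumLattice.fundamentalRep (Fin 2)) β ⌈β ^ θ⌉₊ T - Φ β T| +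
          |Φ β T - 3 / 4 * boxDirCircSqCov ⌈β ^ θ⌉₊ T| := abs_sub_le _ _ _
    _ ≤ ε₁ * (3 / 4 * boxDirCircSqCov ⌈β ^ θ⌉₊ T) + ε₂ * (3 / 4 * boxDirCircSqCov ⌈β ^ θ⌉₊ T) := add_le_add h1 h2
    _ = (ε₁ + ε₂) * (3 / 4 * boxDirCircSqCov ⌈β ^ θ⌉₊ T) := by ring
    _ ≤ 1 / 4 * (3 / 4 * boxDirCircSqCov ⌈β ^ θ⌉₊ T) := mul_le_mul_of_nonneg_right hε (by positivity)

/-- ★ **T-S5.13 reduced to the two analytic steps**: Steps A–C (`box → small-field FP chart`) and Steps D–E (`chart Gaussian → main term`) with relative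
errors `ε₁ + ε₂ ≤ 1/4` on a common bulk window, for every `0 < θ ≤ θL`, give `LandauRelativeComparisonBulk θL`. -/
theorem landauRelativeComparisonBulk_of_split (θL : ℝ)
    (h : ∀ θ : ℝ, 0 < θ → θ ≤ θL → ∃ (Φ : ℝ → ℕ → ℝ) (M L β₀ ε₁ ε₂ : ℝ), 1 ≤ M ∧ ε₁ + ε₂ ≤ 1 / 4 ∧
      (∀ β : ℝ, β₀ ≤ β → ∀ T : ℕ, L ≤ (T : ℝ) → M * (T : ℝ) ≤ (⌈β ^ θ⌉₊ : ℝ) →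
        |β ^ 2 * boxPlaqCov (G := SU2) (Literature.MathematicalPhysics.QuantumLattice.fundamentalRep (Fin 2)) β ⌈β ^ θ⌉₊ T - Φ β T| ≤
          ε₁ * (3 / 4 * boxDirCircSqCov ⌈β ^ θ⌉₊ T)) ∧
      (∀ β : ℝ, β₀ ≤ β → ∀ T : ℕ, L ≤ (T : ℝ) → M * (T : ℝ) ≤ (⌈β ^ θ⌉₊ : ℝ) →
        |Φ β T - 3 / 4 * boxDirCircSqCov ⌈β ^ θ⌉₊ T| ≤ ε₂ * (3 / 4 * boxDirCircSqCov ⌈β ^ θ⌉₊ T))) :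
    LandauRelativeComparisonBulk θL := by
  refine landauRelativeComparisonBulk_of_mainApprox θL fun θ hθ hθL => ?_
  obtain ⟨Φ, M, L, β₀, ε₁, ε₂, hM, hε, hAC, hE⟩ := h θ hθ hθL
  exact mainApprox_of_split θ Φ hM hε hAC hE

end Summit.QuantumFields.YangMills.Theorems.AllWindowsColdBoxBoxHighLine

end
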